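import Literature.Geometry.Lorentzian.KillingCoordInvariants
import Literature.Geometry.Lorentzian.KerrCurvatureInvariantsTransport
import Literature.Geometry.Lorentzian.KerrKillingOrbit
import HarnessLib

/-!
# Killing fields of a rotating Kerr exterior are tangent to the Killing orbits

Infrastructure (all results proved, no definitions) for the named fact
`Literature.Geometry.Lorentzian.ONeill1995_kerrKillingFields` (`KerrKillingAlgebra.lean`; O'Neill,
*The Geometry of Kerr Black Holes* (1995), Cor. 3.7.4: every Killing field of a Kerr spacetime is
a constant combination of `∂̃_t` and `∂̃_φ`). O'Neill's proof (ibid., Prop. 3.7.1, Cor. 3.7.4)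
flows the Killing field and uses that its local isometries `ψ_s` preserve the isometric invariants
`r` and `C² = cos² θ` (Ch. 5: both are functions of the curvature invariants), so that `X r = 0`,
`X C² = 0` and `X` is tangent to the Killing orbits; then the orbit calculation finishes. Here the
same argument is run INFINITESIMALLY, without flows (Mathlib has no differentiable dependence of
ODE flows on initial data), in the ingoing Kerr–Schild Cartesian chart of the tree:

1. **The Killing equation in coordinates** (`OpensChart.killing_coord_of_christoffel`,
   `Kerr.killing_coord_lie_eq_zero`): for a Killing field `X` of a chart metric with components `G`
   and representative `Xf`, `DG_x(X x)(v,w) + G_x(DXf v, w) + G_x(v, DXf w) = 0`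
   (`∇_v X = DXf v + Γ(X)v` and the Koszul form of `Γ`; O'Neill 1983, Prop. 9.25).
2. **Killing fields annihilate the curvature invariants** (`KillingCoordInvariants.lean`:
   `MetricCoord.fderiv_rmNormSqAt_apply_eq_zero`, `fderiv_cubicTrace_apply_eq_zero`): `X |Rm|² = 0`
   and `X 𝒞 = 0` for the Kretschmann scalar and the cubic trace invariant.
3. **The two invariants separate the orbits** (this file, §2): in ingoing Kerr coordinates
   `(t*, r, μ, φ)` the closed forms `|Rm|² = 48 M² Re (r + iaμ)⁶/Σ⁶`, `𝒞 = 48 M³ Re (r + iaμ)⁹/Σ⁹`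
   (`Σ = r² + a²μ²`; they enter as HYPOTHESES `hK`, `hC` in the Kerr–Schild chart, verbatim the
   named fact `Kerr.kretschmannScalar_closedForm` and stub F4 of `stmt-FinalStateConjecture-10047`)
   have Jacobian `∂(|Rm|², 𝒞)/∂(r, μ) = 124416 M⁵ a² μ (3r² − a²μ²)/Σ¹⁰ ≠ 0` off the equatorial
   hyperplane, so `X r = X μ = 0` there (`Kerr.killing_tangent_of_invariants`), i.e. `X³ = 0` and
   `x₁ X¹ + x₂ X² = 0` — `X` is tangent to the orbits of `∂_{t*}`, `∂_{φ*}`; the equatorial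
   hyperplane and the axis are reached by continuity.
4. **Orbit-tangent Killing fields are constant combinations** (`KerrKillingOrbit.lean`,
   `Kerr.killing_tangent_eq_const`, which needs `a ≠ 0`), and the axis by density:
   `Kerr.killingField_eq_combination` — the statement of `ONeill1995_kerrKillingFields` for one
   subextremal rotating Kerr exterior, conditional only on the two closed forms `hK`, `hC`.

## References

* B. O'Neill, *The Geometry of Kerr Black Holes*, A K Peters (1995), §3.7, Prop. 3.7.1,
  Cor. 3.7.4; Ch. 5 (isometric invariants). [ONeill1995]
* B. O'Neill, *Semi-Riemannian geometry* (1983), Ch. 9, Prop. 9.25 (Killing ⇔ `𝓛_X g = 0`). [ONeill1983]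
* R. M. Wald, *General Relativity* (1984), Appendix C.3, (C.3.1), (C.3.6).
* M. Visser, *The Kerr spacetime: a brief introduction*, arXiv:0706.0622, §4–§5. [arXiv07060622]
-/

noncomputable section

set_option maxSynthPendingDepth 3

open Set Function Filter Module Bundle
open scoped Topology ContDiff Manifold
open Literature.Geometry.Lorentzian.MetricCoord

namespace Literature.Geometry.Lorentzian

/-! ### §1 The Killing equation of a chart in coordinates -/

namespace OpensChart

variable {E : Type*} [NormedAddCommGroup E] [NormedSpace ℝ E] [FiniteDimensional ℝ E]
  [CompleteSpace E] {U : TopologicalSpace.Opens E} {n : WithTop ℕ∞} [Fact (1 ≤ n)]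
  {g : PseudoRiemannianMetric 𝓘(ℝ, E) n E (TangentSpace 𝓘(ℝ, E) : U → Type _)}
  {G : E → E →L[ℝ] E →L[ℝ] ℝ} (hG : ∀ y : U, g.val y = G y)

include hG

omit [FiniteDimensional ℝ E] [CompleteSpace E] [Fact (1 ≤ n)] in
/-- The derivative of the (symmetric) components is symmetric in the form slots at points of `U`.
[folklore] -/
theorem fderiv_repr_symm (x : U) (hGx : DifferentiableAt ℝ G x) (v A B : E) :
    fderiv ℝ G x v A B = fderiv ℝ G x v B A := by
  rw [← fderiv_apply₂ G hGx, ← fderiv_apply₂ G hGx]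
  have heq : (fun y ↦ G y A B) =ᶠ[𝓝 (x : E)] fun y ↦ G y B A := by
    filter_upwards [U.isOpen.mem_nhds x.2] with y hy
    have h := g.symm ⟨y, hy⟩ A B
    rw [hG ⟨y, hy⟩] at h
    exact h
  rw [heq.fderiv_eq]

omit [FiniteDimensional ℝ E] [CompleteSpace E] [Fact (1 ≤ n)] hG in
/-- **A Killing field is smooth in coordinates**: the representative `Xf` of a Killing field `X` of
a metric on `U : Opens E` (`X y = Xf y` on `U`) is `C^n` at the points of `U`. [folklore] -/
theorem _root_.Literature.Geometry.Lorentzian.PseudoRiemannianMetric.IsKillingField.contDiffAt_coordRepr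
    [g.HasLeviCivita] {X : Π y : U, TangentSpace 𝓘(ℝ, E) y} (hX : g.IsKillingField X) {Xf : E → E}
    (hXf : ∀ y : U, X y = Xf y) (x : U) : ContDiffAt ℝ n Xf x := by
  have h := hX.contMDiff x
  rw [ModelWithCorners.tangent, contMDiffAt_section_iff x X, contMDiffAt_iff x _ Xf hXf] at h
  exact h

omit [CompleteSpace E] [Fact (1 ≤ n)] in
/-- **The Killing equation in coordinates, algebraic core.** If at a point `x` of the chart the
metric pairing `G_x(A v + Γ_x(Z)v, w) + G_x(v, A w + Γ_x(Z)w)` vanishes for all `v, w` (the Killing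
equation `g(∇_v X, w) + g(v, ∇_w X) = 0` with `∇_v X = A v + Γ(Z) v`, `Z = X x`, `A = DXf_x`), then
`DG_x(Z)(v, w) + G_x(A v, w) + G_x(v, A w) = 0` — because `g(Γ(Z)v, w) + g(v, Γ(Z)w) = ∂_Z g(v,w)`
by the Koszul formula for `Γ` (`two_mul_val_christoffel`). O'Neill 1983, Ch. 9, Prop. 9.25; Wald
1984, (C.3.1). [cite: ONeill1983, Ch. 9, Prop. 9.25] -/
theorem killing_coord_of_christoffel (x : U) (hGx : DifferentiableAt ℝ G x) (Z : E)
    (A : E →L[ℝ] E)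
    (hK : ∀ v w : E, G x (A v + christoffel g G x Z v) w + G x v (A w + christoffel g G x Z w) = 0)
    (v w : E) : fderiv ℝ G x Z v w + G x (A v) w + G x v (A w) = 0 := by
  have hKvw := hK v w
  rw [map_add, _root_.add_apply, map_add] at hKvw
  have h2 := two_mul_val_christoffel (g := g) (G := G) x Z v w
  have h3 := two_mul_val_christoffel (g := g) (G := G) x Z w v
  rw [koszulForm_apply, hG x] at h2 h3
  have hsym : ∀ P Q : E, G x P Q = G x Q P := fun P Q ↦ by
    have := g.symm x P Q; rwa [hG x] at this
  have hs := hsym v (christoffel g G x Z w)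
  have hs1 := fderiv_repr_symm hG x hGx v Z w
  have hs2 := fderiv_repr_symm hG x hGx w Z v
  have hs3 := fderiv_repr_symm hG x hGx Z w v
  linear_combination hKvw - (1 / 2 : ℝ) * h2 - (1 / 2 : ℝ) * h3 - hs - (1 / 2 : ℝ) * hs1 -
    (1 / 2 : ℝ) * hs2 - (1 / 2 : ℝ) * hs3

end OpensChart

namespace Kerr

/-- **The Killing equation in the Kerr–Schild chart.** For a Killing field `X` of the `C^∞` Kerr
metric `Kerr.smoothMetric M a r₀` on the chart domain `Kerr.region a r₀`, with representative
`Xf` (`X y = Xf y`), the coordinate Lie derivative of the Kerr–Schild components along `X`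
vanishes: `DG_x(X x)(v, w) + G_x(DXf_x v, w) + G_x(v, DXf_x w) = 0`, `G = Kerr.bilin M a`
(`X^λ ∂_λ g_{μν} + g_{λν} ∂_μ X^λ + g_{μλ} ∂_ν X^λ = 0`). O'Neill 1983, Prop. 9.25; Wald 1984,
(C.3.1). [cite: ONeill1983, Ch. 9, Prop. 9.25] -/
theorem killing_coord_lie_eq_zero [Facts] (M a r₀ : ℝ) [(smoothMetric M a r₀).HasLeviCivita]
    {X : Π y : region a r₀, TangentSpace 𝓘(ℝ, E4) y}
    (hX : (smoothMetric M a r₀).toPseudoRiemannianMetric.IsKillingField X) {Xf : E4 → E4}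
    (hXf : ∀ y : region a r₀, X y = Xf y) (x : region a r₀) (v w : E4) :
    fderiv ℝ (bilin M a) x (Xf x) v w + bilin M a x (fderiv ℝ Xf x v) w +
      bilin M a x v (fderiv ℝ Xf x w) = 0 := by
  set g := (smoothMetric M a r₀).toPseudoRiemannianMetric with hg
  have hG : ∀ y : region a r₀, g.val y = bilin M a y := fun y ↦ rfl
  have hXd : DifferentiableAt ℝ Xf x := (hX.contDiffAt_coordRepr hXf x).differentiableAt (by simp)
  have hlc : ∀ W : E4, g.leviCivita X x W =
      fderiv ℝ Xf x W + OpensChart.christoffel g (bilin M a) x (Xf x) W := by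
    intro W
    rw [OpensChart.leviCivita_apply_eq hG x hXf hXd W, hXf x]
  refine OpensChart.killing_coord_of_christoffel hG x (differentiableAt_bilin M a x) (Xf x)
    (fderiv ℝ Xf x) (fun v w ↦ ?_) v w
  have hK := hX.val_leviCivita_add x v w
  rw [hlc v, hlc w] at hK
  exact hK

/-! ### §2 The closed-form invariants separate the Killing orbits -/

namespace Ingoing

variable {f : E4 → ℝ} {u : E4} {f₁ f₂ : ℝ}

/-- Powers of a `HasGrad` function. [folklore] -/
theorem HasGrad.pow (hf : HasGrad f u f₁ f₂) (n : ℕ) :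
    HasGrad (fun u ↦ f u ^ n) u (n * f u ^ (n - 1) * f₁) (n * f u ^ (n - 1) * f₂) := by
  have h := HasFDerivAt.pow hf n
  refine h.congr_fderiv ?_
  simp only [smul_add, smul_smul, nsmul_eq_mul]

variable (M a : ℝ)

/-- **Gradient of the Kretschmann closed form** `k = 48 M² Re (r + is)⁶/(r² + s²)⁶`, `r = u¹`,
`s = a u²`: `∂_r k = −288 M² Re (r + is)⁷/Σ⁷`, `∂_μ k = −288 M² a Im (r + is)⁷/Σ⁷`
(`k = 48 M² Re (r − is)⁻⁶`). [cite: arXiv07060622, §5] -/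
theorem hasGrad_kretschmannClosedForm (hS0 : u 1 ^ 2 + (a * u 2) ^ 2 ≠ 0) :
    HasGrad (fun u : E4 ↦ 48 * M ^ 2 * (u 1 ^ 6 - 15 * u 1 ^ 4 * (a * u 2) ^ 2 +
        15 * u 1 ^ 2 * (a * u 2) ^ 4 - (a * u 2) ^ 6) / (u 1 ^ 2 + (a * u 2) ^ 2) ^ 6) u
      (-(288 * M ^ 2 * (u 1 ^ 7 - 21 * u 1 ^ 5 * (a * u 2) ^ 2 + 35 * u 1 ^ 3 * (a * u 2) ^ 4 -
        7 * u 1 * (a * u 2) ^ 6)) / (u 1 ^ 2 + (a * u 2) ^ 2) ^ 7)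
      (-(288 * M ^ 2 * a * (7 * u 1 ^ 6 * (a * u 2) - 35 * u 1 ^ 4 * (a * u 2) ^ 3 +
        21 * u 1 ^ 2 * (a * u 2) ^ 5 - (a * u 2) ^ 7)) / (u 1 ^ 2 + (a * u 2) ^ 2) ^ 7) := by
  have hr := HasGrad.fst u
  have hs : HasGrad (fun u : E4 ↦ a * u 2) u 0 a :=
    ((HasGrad.snd u).const_mul a).congr (by ring) (by ring)
  have hS := (hr.sq).add (hs.sq)
  have hnum := ((((hr.pow 6).sub (((hr.pow 4).const_mul 15).mul hs.sq)).add
    (((hr.sq).const_mul 15).mul (hs.pow 4))).sub (hs.pow 6)).const_mul (48 * M ^ 2)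
  have h := hnum.div (hS.pow 6) (pow_ne_zero 6 hS0)
  have h2 : ((u 1 ^ 2 + (a * u 2) ^ 2) ^ 6) ^ 2 ≠ 0 := pow_ne_zero 2 (pow_ne_zero 6 hS0)
  refine h.congr ?_ ?_
  · beta_reduce
    rw [div_eq_div_iff h2 (pow_ne_zero _ hS0)]
    ring
  · beta_reduce
    rw [div_eq_div_iff h2 (pow_ne_zero _ hS0)]
    ring

/-- **Gradient of the cubic closed form** `c = 48 M³ Re (r + is)⁹/(r² + s²)⁹`, `r = u¹`, `s = a u²`:
`∂_r c = −432 M³ Re (r + is)¹⁰/Σ¹⁰`, `∂_μ c = −432 M³ a Im (r + is)¹⁰/Σ¹⁰`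
(`c = 48 M³ Re (r − is)⁻⁹`). [cite: arXiv07060622, §5] -/
theorem hasGrad_cubicClosedForm (hS0 : u 1 ^ 2 + (a * u 2) ^ 2 ≠ 0) :
    HasGrad (fun u : E4 ↦ 48 * M ^ 3 * (u 1 ^ 9 - 36 * u 1 ^ 7 * (a * u 2) ^ 2 +
        126 * u 1 ^ 5 * (a * u 2) ^ 4 - 84 * u 1 ^ 3 * (a * u 2) ^ 6 + 9 * u 1 * (a * u 2) ^ 8) /
        (u 1 ^ 2 + (a * u 2) ^ 2) ^ 9) u
      (-(432 * M ^ 3 * (u 1 ^ 10 - 45 * u 1 ^ 8 * (a * u 2) ^ 2 + 210 * u 1 ^ 6 * (a * u 2) ^ 4 -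
        210 * u 1 ^ 4 * (a * u 2) ^ 6 + 45 * u 1 ^ 2 * (a * u 2) ^ 8 - (a * u 2) ^ 10)) /
        (u 1 ^ 2 + (a * u 2) ^ 2) ^ 10)
      (-(432 * M ^ 3 * a * (10 * u 1 ^ 9 * (a * u 2) - 120 * u 1 ^ 7 * (a * u 2) ^ 3 +
        252 * u 1 ^ 5 * (a * u 2) ^ 5 - 120 * u 1 ^ 3 * (a * u 2) ^ 7 + 10 * u 1 * (a * u 2) ^ 9)) /
        (u 1 ^ 2 + (a * u 2) ^ 2) ^ 10) := by
  have hr := HasGrad.fst u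
  have hs : HasGrad (fun u : E4 ↦ a * u 2) u 0 a :=
    ((HasGrad.snd u).const_mul a).congr (by ring) (by ring)
  have hS := (hr.sq).add (hs.sq)
  have hnum := (((((hr.pow 9).sub (((hr.pow 7).const_mul 36).mul hs.sq)).add
    (((hr.pow 5).const_mul 126).mul (hs.pow 4))).sub (((hr.pow 3).const_mul 84).mul (hs.pow 6))).add
    ((hr.const_mul 9).mul (hs.pow 8))).const_mul (48 * M ^ 3)
  have h := hnum.div (hS.pow 9) (pow_ne_zero 9 hS0)
  have h2 : ((u 1 ^ 2 + (a * u 2) ^ 2) ^ 9) ^ 2 ≠ 0 := pow_ne_zero 2 (pow_ne_zero 9 hS0)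
  refine h.congr ?_ ?_
  · beta_reduce
    rw [div_eq_div_iff h2 (pow_ne_zero _ hS0)]
    ring
  · beta_reduce
    rw [div_eq_div_iff h2 (pow_ne_zero _ hS0)]
    ring

/-- **The Jacobian `∂(|Rm|², 𝒞)/∂(r, μ)` does not vanish off the equatorial hyperplane**: with the
four partial derivatives above, `k_r c_μ − k_μ c_r = 124416 M⁵ a² μ (3r² − a²μ²)/Σ¹⁰`
(`Re w⁷ · Im w¹⁰ − Im w⁷ · Re w¹⁰ = |w|¹⁴ Im w³`, `w = r + iaμ`), nonzero for `M ≠ 0`, `a ≠ 0`,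
`μ ≠ 0` and `a²μ² < 3r²`. This is the infinitesimal form of "r and C² are isometric invariants"
(O'Neill 1995, Ch. 5; Prop. 3.7.1). [cite: ONeill1995, §3.7, Prop. 3.7.1] -/
theorem invariantsJacobian_ne_zero (hM : M ≠ 0) (ha : a ≠ 0) (hu2 : u 2 ≠ 0)
    (hlt : (a * u 2) ^ 2 < 3 * u 1 ^ 2) (hS0 : u 1 ^ 2 + (a * u 2) ^ 2 ≠ 0) :
    -(288 * M ^ 2 * (u 1 ^ 7 - 21 * u 1 ^ 5 * (a * u 2) ^ 2 + 35 * u 1 ^ 3 * (a * u 2) ^ 4 -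
        7 * u 1 * (a * u 2) ^ 6)) / (u 1 ^ 2 + (a * u 2) ^ 2) ^ 7 *
      (-(432 * M ^ 3 * a * (10 * u 1 ^ 9 * (a * u 2) - 120 * u 1 ^ 7 * (a * u 2) ^ 3 +
        252 * u 1 ^ 5 * (a * u 2) ^ 5 - 120 * u 1 ^ 3 * (a * u 2) ^ 7 + 10 * u 1 * (a * u 2) ^ 9)) /
        (u 1 ^ 2 + (a * u 2) ^ 2) ^ 10) -
    -(288 * M ^ 2 * a * (7 * u 1 ^ 6 * (a * u 2) - 35 * u 1 ^ 4 * (a * u 2) ^ 3 +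
        21 * u 1 ^ 2 * (a * u 2) ^ 5 - (a * u 2) ^ 7)) / (u 1 ^ 2 + (a * u 2) ^ 2) ^ 7 *
      (-(432 * M ^ 3 * (u 1 ^ 10 - 45 * u 1 ^ 8 * (a * u 2) ^ 2 + 210 * u 1 ^ 6 * (a * u 2) ^ 4 -
        210 * u 1 ^ 4 * (a * u 2) ^ 6 + 45 * u 1 ^ 2 * (a * u 2) ^ 8 - (a * u 2) ^ 10)) /
        (u 1 ^ 2 + (a * u 2) ^ 2) ^ 10) ≠ 0 := by
  rw [div_mul_div_comm, div_mul_div_comm, ← sub_div]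
  refine div_ne_zero ?_ (mul_ne_zero (pow_ne_zero _ hS0) (pow_ne_zero _ hS0))
  have hid : -(288 * M ^ 2 * (u 1 ^ 7 - 21 * u 1 ^ 5 * (a * u 2) ^ 2 + 35 * u 1 ^ 3 * (a * u 2) ^ 4 -
        7 * u 1 * (a * u 2) ^ 6)) *
      -(432 * M ^ 3 * a * (10 * u 1 ^ 9 * (a * u 2) - 120 * u 1 ^ 7 * (a * u 2) ^ 3 +
        252 * u 1 ^ 5 * (a * u 2) ^ 5 - 120 * u 1 ^ 3 * (a * u 2) ^ 7 + 10 * u 1 * (a * u 2) ^ 9)) -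
      -(288 * M ^ 2 * a * (7 * u 1 ^ 6 * (a * u 2) - 35 * u 1 ^ 4 * (a * u 2) ^ 3 +
        21 * u 1 ^ 2 * (a * u 2) ^ 5 - (a * u 2) ^ 7)) *
      -(432 * M ^ 3 * (u 1 ^ 10 - 45 * u 1 ^ 8 * (a * u 2) ^ 2 + 210 * u 1 ^ 6 * (a * u 2) ^ 4 -
        210 * u 1 ^ 4 * (a * u 2) ^ 6 + 45 * u 1 ^ 2 * (a * u 2) ^ 8 - (a * u 2) ^ 10)) =
      124416 * M ^ 5 * a * (a * u 2) * (3 * u 1 ^ 2 - (a * u 2) ^ 2) *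
        (u 1 ^ 2 + (a * u 2) ^ 2) ^ 7 := by
    ring
  rw [hid]
  have h3 : 3 * u 1 ^ 2 - (a * u 2) ^ 2 ≠ 0 := (sub_pos.2 hlt).ne'
  have h5 : (124416 : ℝ) * M ^ 5 ≠ 0 := mul_ne_zero (by norm_num) (pow_ne_zero _ hM)
  exact mul_ne_zero (mul_ne_zero (mul_ne_zero (mul_ne_zero h5 ha) (mul_ne_zero ha hu2)) h3)
    (pow_ne_zero _ hS0)

/-- The four closed-form partial derivatives and the nonvanishing Jacobian, packaged: at a point
of the coordinate space with `r > 0`, `μ ≠ 0`, `a²μ² < 3r²` (and `M ≠ 0`, `a ≠ 0`) the closed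
forms `k`, `c` have gradients `(k_r, k_μ)`, `(c_r, c_μ)` with `k_r c_μ − k_μ c_r ≠ 0`.
[cite: ONeill1995, §3.7, Prop. 3.7.1] -/
theorem exists_hasGrad_invariants (hM : M ≠ 0) (ha : a ≠ 0) (hu1 : 0 < u 1) (hu2 : u 2 ≠ 0)
    (hlt : (a * u 2) ^ 2 < 3 * u 1 ^ 2) :
    ∃ k₁ k₂ c₁ c₂ : ℝ,
      HasGrad (fun u : E4 ↦ 48 * M ^ 2 * (u 1 ^ 6 - 15 * u 1 ^ 4 * (a * u 2) ^ 2 +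
        15 * u 1 ^ 2 * (a * u 2) ^ 4 - (a * u 2) ^ 6) / (u 1 ^ 2 + (a * u 2) ^ 2) ^ 6) u k₁ k₂ ∧
      HasGrad (fun u : E4 ↦ 48 * M ^ 3 * (u 1 ^ 9 - 36 * u 1 ^ 7 * (a * u 2) ^ 2 +
        126 * u 1 ^ 5 * (a * u 2) ^ 4 - 84 * u 1 ^ 3 * (a * u 2) ^ 6 + 9 * u 1 * (a * u 2) ^ 8) /
        (u 1 ^ 2 + (a * u 2) ^ 2) ^ 9) u c₁ c₂ ∧
      k₁ * c₂ - k₂ * c₁ ≠ 0 := by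
  have hS0 : u 1 ^ 2 + (a * u 2) ^ 2 ≠ 0 := by positivity
  exact ⟨_, _, _, _, hasGrad_kretschmannClosedForm M a hS0, hasGrad_cubicClosedForm M a hS0,
    invariantsJacobian_ne_zero M a hM ha hu2 hlt hS0⟩

end Ingoing

/-! ### §3 Killing fields are tangent to the Killing orbits -/

/-- **The equatorial hyperplane is nowhere dense off the axis, in the form used for identities**:
a function continuous on `Kerr.region a r₀` taking the value `c` at every off-axis point with
`x₃ ≠ 0` takes the value `c` at every off-axis point (approach `x` by `x + t ∂₃`, `t → 0`).
[folklore] -/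
theorem eqOn_offAxis_of_ne_three {X : Type*} [TopologicalSpace X] [T2Space X] {a r₀ : ℝ}
    {G : E4 → X} {c : X} (hG : ContinuousOn G (region a r₀))
    (h : ∀ y ∈ region a r₀, (y 1 ≠ 0 ∨ y 2 ≠ 0) → y 3 ≠ 0 → G y = c) :
    ∀ y ∈ region a r₀, (y 1 ≠ 0 ∨ y 2 ≠ 0) → G y = c := by
  intro y hy hax
  by_cases h3 : y 3 ≠ 0
  · exact h y hy hax h3
  push Not at h3
  set γ : ℝ → E4 := fun t ↦ y + t • E4.basisVector 3 with hγ
  have hγc : Continuous γ := by fun_prop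
  have hγ0 : γ 0 = y := by simp [hγ]
  have hopen : IsOpen (region a r₀ : Set E4) := (region a r₀).isOpen
  have hev : ∀ᶠ t in 𝓝 (0 : ℝ), γ t ∈ (region a r₀ : Set E4) := by
    have : (region a r₀ : Set E4) ∈ 𝓝 (γ 0) := by rw [hγ0]; exact hopen.mem_nhds hy
    exact hγc.continuousAt.preimage_mem_nhds this
  have hev' : ∀ᶠ t in 𝓝[≠] (0 : ℝ), G (γ t) = c := by
    filter_upwards [mem_nhdsWithin_of_mem_nhds hev, self_mem_nhdsWithin] with t ht ht0
    refine h _ ht ?_ ?_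
    · simpa [hγ, E4.basisVector] using hax
    · simpa [hγ, E4.basisVector, h3] using ht0
  have htend : Tendsto (fun t ↦ G (γ t)) (𝓝[≠] (0 : ℝ)) (𝓝 (G y)) := by
    have h1 : Tendsto γ (𝓝[≠] (0 : ℝ)) (𝓝[(region a r₀ : Set E4)] y) := by
      refine tendsto_nhdsWithin_iff.2 ⟨?_, mem_nhdsWithin_of_mem_nhds hev⟩
      rw [← hγ0]
      exact hγc.continuousAt.tendsto.mono_left nhdsWithin_le_nhds
    exact (hG y hy).tendsto.comp h1
  have hconst : Tendsto (fun t ↦ G (γ t)) (𝓝[≠] (0 : ℝ)) (𝓝 c) :=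
    tendsto_const_nhds.congr' (hev'.mono fun t ht ↦ ht.symm)
  exact tendsto_nhds_unique htend hconst

/-- **Killing fields of a rotating subextremal Kerr exterior are tangent to the Killing orbits.**
Let `Xf` be `C^∞` on the exterior block `Kerr.region a r₊` and satisfy the coordinate Killing
equation for the Kerr–Schild components there (`Kerr.killing_coord_lie_eq_zero`), and assume the
closed forms of the Kretschmann scalar (`hK`, verbatim `Kerr.kretschmannScalar_closedForm`) and of
the cubic trace invariant (`hC`, verbatim stub F4 of `stmt-FinalStateConjecture-10047`) for these
`M > |a| > 0`. Then `X x₃ = 0` and `x₁ X¹ + x₂ X² = 0` at every point: `X` annihilates both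
invariants (`KillingCoordInvariants.lean`), in ingoing Kerr coordinates their Jacobian in `(r, μ)`
is invertible off `{μ = 0}` (`Kerr.Ingoing.invariantsJacobian_ne_zero`), so the `∂_r`, `∂_μ`
components of `X` vanish and `X ∈ span(∂_{t*}, ∂_φ)`, whose members have `X³ = 0`,
`x₁X¹ + x₂X² = 0`; the hyperplane `{x₃ = 0}` and the axis follow by continuity. This is O'Neill's
"`r` and `C²` are isometric invariants, hence preserved" (Prop. 3.7.1, Ch. 5) in infinitesimal
form. [cite: ONeill1995, §3.7, Prop. 3.7.1 and Cor. 3.7.4] -/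
theorem killing_tangent_of_invariants {M a : ℝ} (hM : 0 < M) (ha : a ≠ 0) (haM : IsSubextremal M a)
    (hK : ∀ x : E4, 0 < radius a x → rmNormSqAt (Kerr.bilin M a) x =
      48 * M ^ 2 * (((radius a x : ℂ) + ((a * (x 3 / radius a x) : ℝ) : ℂ) * Complex.I) ^ 6).re /
        (radius a x ^ 2 + (a * (x 3 / radius a x)) ^ 2) ^ 6)
    (hC : ∀ x : E4, 0 < radius a x → ∀ b : Module.Basis (Fin 4) ℝ E4,
      ∑ i, ∑ i', ∑ j, ∑ j', ∑ k, ∑ k',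
        ginv (Kerr.bilin M a) b x i i' * ginv (Kerr.bilin M a) b x j j' *
        ginv (Kerr.bilin M a) b x k k' *
        traceCLM E4 ((riemAt (Kerr.bilin M a) x (b i) (b j)).comp
          ((riemAt (Kerr.bilin M a) x (b j') (b k)).comp
            (riemAt (Kerr.bilin M a) x (b k') (b i')))) =
      48 * M ^ 3 * (((radius a x : ℂ) + ((a * (x 3 / radius a x) : ℝ) : ℂ) * Complex.I) ^ 9).re /
        (radius a x ^ 2 + (a * (x 3 / radius a x)) ^ 2) ^ 9)
    {Xf : E4 → E4} (hXf : ContDiffOn ℝ ∞ Xf (region a (rPlus M a)))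
    (hLG : ∀ x ∈ (region a (rPlus M a) : Set E4), ∀ v w : E4,
      fderiv ℝ (bilin M a) x (Xf x) v w + bilin M a x (fderiv ℝ Xf x v) w +
        bilin M a x v (fderiv ℝ Xf x w) = 0) :
    ∀ x ∈ region a (rPlus M a), Xf x 3 = 0 ∧ x 1 * Xf x 1 + x 2 * Xf x 2 = 0 := by
  have hG := KerrSchildChart.isMetricOn_kerrBilin M a (rPlus M a)
  set b : Module.Basis (Fin 4) ℝ E4 := (EuclideanSpace.basisFun (Fin 4) ℝ).toBasis with hb
  -- the two invariants as functions on the chart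
  obtain ⟨K, hKdef⟩ : ∃ K : E4 → ℝ, K = rmNormSqAt (Kerr.bilin M a) := ⟨_, rfl⟩
  obtain ⟨C, hCdef⟩ : ∃ C : E4 → ℝ, C = fun x ↦ ∑ i, ∑ i', ∑ j, ∑ j', ∑ k, ∑ k',
        ginv (Kerr.bilin M a) b x i i' * ginv (Kerr.bilin M a) b x j j' *
        ginv (Kerr.bilin M a) b x k k' *
        traceCLM E4 ((riemAt (Kerr.bilin M a) x (b i) (b j)).comp
          ((riemAt (Kerr.bilin M a) x (b j') (b k)).comp
            (riemAt (Kerr.bilin M a) x (b k') (b i')))) := ⟨_, rfl⟩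
  have hKs : ContDiffOn ℝ ∞ K (region a (rPlus M a)) := by
    rw [hKdef]; exact hG.contDiffOn_rmNormSqAt
  have hCs : ContDiffOn ℝ ∞ C (region a (rPlus M a)) := by
    rw [hCdef]; exact hG.contDiffOn_cubicTrace b
  -- Killing fields annihilate both invariants
  have hXK : ∀ x ∈ (region a (rPlus M a) : Set E4), fderiv ℝ K x (Xf x) = 0 := fun x hx ↦ by
    rw [hKdef]; exact fderiv_rmNormSqAt_apply_eq_zero hG hXf hLG hx
  have hXC : ∀ x ∈ (region a (rPlus M a) : Set E4), fderiv ℝ C x (Xf x) = 0 := fun x hx ↦ by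
    rw [hCdef]; exact fderiv_cubicTrace_apply_eq_zero b hG hXf hLG hx
  -- the core: off the axis and off the equatorial hyperplane, in ingoing Kerr coordinates
  have hcore : ∀ y ∈ region a (rPlus M a), (y 1 ≠ 0 ∨ y 2 ≠ 0) → y 3 ≠ 0 →
      Xf y 3 = 0 ∧ y 1 * Xf y 1 + y 2 * Xf y 2 = 0 := by
    intro y hy hax hy3
    obtain ⟨u, hu, rfl⟩ := Ingoing.exists_chartFun_eq hy hax
    have hu1 : 0 < u 1 := Ingoing.radial_pos hu
    have hrp : rPlus M a < u 1 := (le_max_left _ _).trans_lt hu.1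
    have hMu : M < u 1 := by
      have : M ≤ rPlus M a := le_add_of_nonneg_right (Real.sqrt_nonneg _)
      linarith
    have hu2 : u 2 ≠ 0 := by
      intro h0
      apply hy3
      rw [Ingoing.chartFun_apply_three a hu, h0, mul_zero]
    have hlt : (a * u 2) ^ 2 < 3 * u 1 ^ 2 := by
      have h21 : u 2 ^ 2 < 1 := by
        have := hu.2.1
        have := hu.2.2
        nlinarith
      have haM' := abs_lt.1 haM
      have ha2 : a ^ 2 < M ^ 2 := by nlinarith
      have hM2 : M ^ 2 < u 1 ^ 2 := by nlinarith
      have : a ^ 2 * u 2 ^ 2 ≤ a ^ 2 * 1 := by gcongr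
      nlinarith
    obtain ⟨k₁, k₂, c₁, c₂, hk, hc, hdet⟩ :=
      Ingoing.exists_hasGrad_invariants M a hM.ne' ha hu1 hu2 hlt
    -- the closed forms along the chart, near `u`
    have hrad : ∀ u' ∈ (Ingoing.coordDomain (rPlus M a) : Set E4),
        radius a (Ingoing.chartFun a (rPlus M a) u') = u' 1 := fun u' hu' ↦
      Ingoing.radius_chartFun_of_mem a hu'
    have hkev : (fun u' : E4 ↦ 48 * M ^ 2 * (u' 1 ^ 6 - 15 * u' 1 ^ 4 * (a * u' 2) ^ 2 +
        15 * u' 1 ^ 2 * (a * u' 2) ^ 4 - (a * u' 2) ^ 6) / (u' 1 ^ 2 + (a * u' 2) ^ 2) ^ 6) =ᶠ[𝓝 u]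
        (K ∘ Ingoing.chartFun a (rPlus M a)) := by
      filter_upwards [(Ingoing.coordDomain (rPlus M a)).isOpen.mem_nhds hu] with u' hu'
      have hr' : 0 < radius a (Ingoing.chartFun a (rPlus M a) u') := by
        rw [hrad u' hu']; exact Ingoing.radial_pos hu'
      rw [comp_apply, hKdef, hK _ hr', Ingoing.mul_apply_three_div_radius a hu', hrad u' hu',
        Complex.re_add_mul_I_pow_six]
    have hcev : (fun u' : E4 ↦ 48 * M ^ 3 * (u' 1 ^ 9 - 36 * u' 1 ^ 7 * (a * u' 2) ^ 2 +
        126 * u' 1 ^ 5 * (a * u' 2) ^ 4 - 84 * u' 1 ^ 3 * (a * u' 2) ^ 6 +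
        9 * u' 1 * (a * u' 2) ^ 8) / (u' 1 ^ 2 + (a * u' 2) ^ 2) ^ 9) =ᶠ[𝓝 u]
        (C ∘ Ingoing.chartFun a (rPlus M a)) := by
      filter_upwards [(Ingoing.coordDomain (rPlus M a)).isOpen.mem_nhds hu] with u' hu'
      have hr' : 0 < radius a (Ingoing.chartFun a (rPlus M a) u') := by
        rw [hrad u' hu']; exact Ingoing.radial_pos hu'
      rw [comp_apply, hCdef]
      beta_reduce
      rw [hC _ hr' b, Ingoing.mul_apply_three_div_radius a hu', hrad u' hu',
        Complex.re_add_mul_I_pow_nine]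
    -- the chain rule along the chart identifies the gradients
    have hy' : Ingoing.chartFun a (rPlus M a) u ∈ (region a (rPlus M a) : Set E4) := hy
    have hnhds : (region a (rPlus M a) : Set E4) ∈ 𝓝 (Ingoing.chartFun a (rPlus M a) u) :=
      (region a (rPlus M a)).isOpen.mem_nhds hy'
    have hKd : DifferentiableAt ℝ K (Ingoing.chartFun a (rPlus M a) u) :=
      (hKs.differentiableOn (by simp)).differentiableAt hnhds
    have hCd : DifferentiableAt ℝ C (Ingoing.chartFun a (rPlus M a) u) :=
      (hCs.differentiableOn (by simp)).differentiableAt hnhds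
    have hk' := (hKd.hasFDerivAt.comp u (Ingoing.hasFDerivAt_chartFun hu)).congr_of_eventuallyEq
      hkev
    have hc' := (hCd.hasFDerivAt.comp u (Ingoing.hasFDerivAt_chartFun hu)).congr_of_eventuallyEq
      hcev
    -- the Jacobian is onto: `Xf = J W`
    obtain ⟨e, he⟩ :=
      KerrSchildChart.isInvertible_of_injective (Ingoing.jac_injective (a := a) hu)
    set W : E4 := e.symm (Xf (Ingoing.chartFun a (rPlus M a) u)) with hW
    have hJW : Ingoing.jac a u W = Xf (Ingoing.chartFun a (rPlus M a) u) := by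
      rw [← he, hW]
      simp
    have e1 : k₁ * W 1 + k₂ * W 2 = 0 := by
      rw [← hk.fderiv_apply W, hk'.fderiv, ContinuousLinearMap.comp_apply, hJW]
      exact hXK _ hy'
    have e2 : c₁ * W 1 + c₂ * W 2 = 0 := by
      rw [← hc.fderiv_apply W, hc'.fderiv, ContinuousLinearMap.comp_apply, hJW]
      exact hXC _ hy'
    have hW1 : W 1 = 0 := by
      have h := mul_eq_zero.1
        (show W 1 * (k₁ * c₂ - k₂ * c₁) = 0 by linear_combination c₂ * e1 - k₂ * e2)
      exact h.resolve_right hdet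
    have hW2 : W 2 = 0 := by
      have h := mul_eq_zero.1
        (show W 2 * (k₁ * c₂ - k₂ * c₁) = 0 by linear_combination k₁ * e2 - c₁ * e1)
      exact h.resolve_right hdet
    -- hence `Xf = W⁰ ∂_{t*} + W³ ∂_φ`, tangent to the orbit
    have hXeq : Xf (Ingoing.chartFun a (rPlus M a) u) =
        E4.ofTimeSpace (W 0) (W 3 • Ingoing.jacP a u) := by
      rw [← hJW, Ingoing.jac_apply, hW1, hW2, zero_smul, zero_smul, zero_add, zero_add]
    have hx1 : Ingoing.chartFun a (rPlus M a) u 1 =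
        (u 1 * Real.cos (u 3) - a * Real.sin (u 3)) * Ingoing.sroot u := by
      rw [Ingoing.chartFun_eq hu, show ∀ (t : ℝ) (y : E3), E4.ofTimeSpace t y 1 = y 0 from
        fun _ _ ↦ rfl, kerrStar_apply_zero, Ingoing.sin_arccos_eq]
    have hx2 : Ingoing.chartFun a (rPlus M a) u 2 =
        (u 1 * Real.sin (u 3) + a * Real.cos (u 3)) * Ingoing.sroot u := by
      rw [Ingoing.chartFun_eq hu, show ∀ (t : ℝ) (y : E3), E4.ofTimeSpace t y 2 = y 1 from
        fun _ _ ↦ rfl, kerrStar_apply_one, Ingoing.sin_arccos_eq]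
    refine ⟨?_, ?_⟩
    · rw [hXeq, show ∀ (t : ℝ) (y : E3), E4.ofTimeSpace t y 3 = y 2 from fun _ _ ↦ rfl]
      simp [Ingoing.jacP]
    · rw [hx1, hx2, hXeq, show ∀ (t : ℝ) (y : E3), E4.ofTimeSpace t y 1 = y 0 from fun _ _ ↦ rfl,
        show ∀ (t : ℝ) (y : E3), E4.ofTimeSpace t y 2 = y 1 from fun _ _ ↦ rfl]
      simp [Ingoing.jacP]
      ring
  -- continuity: the equatorial hyperplane and the axis
  have hp : ∀ i : Fin 4, Continuous fun x : E4 ↦ x i := fun i ↦ (EuclideanSpace.proj i).continuous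
  have hXc : ContinuousOn Xf (region a (rPlus M a)) := hXf.continuousOn
  have hcont1 : ContinuousOn (fun y : E4 ↦ Xf y 3) (region a (rPlus M a)) :=
    (hp 3).comp_continuousOn hXc
  have hcont2 : ContinuousOn (fun y : E4 ↦ y 1 * Xf y 1 + y 2 * Xf y 2) (region a (rPlus M a)) :=
    ((hp 1).continuousOn.mul ((hp 1).comp_continuousOn hXc)).add
      ((hp 2).continuousOn.mul ((hp 2).comp_continuousOn hXc))
  intro x hx
  exact ⟨eqOn_region_of_offAxis hcont1
      (eqOn_offAxis_of_ne_three hcont1 fun y hy hax hy3 ↦ (hcore y hy hax hy3).1) x hx,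
    eqOn_region_of_offAxis hcont2
      (eqOn_offAxis_of_ne_three hcont2 fun y hy hax hy3 ↦ (hcore y hy hax hy3).2) x hx⟩

/-! ### §4 Every Killing field is a constant combination of `∂_{t*}` and `∂_{φ*}` -/

/-- **O'Neill's Corollary 3.7.4 for the rotating subextremal Kerr exterior, conditional on the two
closed-form curvature invariants.** For `a ≠ 0`, `|a| < M`, every Killing field `X` of the `C^∞`
Kerr metric on the exterior block `Kerr.exterior M a` (ingoing Kerr–Schild Cartesian chart) is
`α ∂_{t*} + β ∂_{φ*}` with CONSTANT `α, β` — given the Kretschmann closed form `hK` (verbatim the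
named fact `Kerr.kretschmannScalar_closedForm` at `M, a`) and the cubic trace closed form `hC`.
Proof: the Killing equation in coordinates (§1), tangency to the orbits (§3), the orbit
calculation `Kerr.killing_tangent_eq_const` (`KerrKillingOrbit.lean`) off the axis, and the axis by
density (`Kerr.eq_of_offAxis_region`). [cite: ONeill1995, §3.7, Cor. 3.7.4] -/
theorem killingField_eq_combination [Facts] (M a : ℝ) [(smoothMetric M a (rPlus M a)).HasLeviCivita]
    (ha : a ≠ 0) (hsub : IsSubextremal M a)
    (hK : ∀ x : E4, 0 < radius a x → rmNormSqAt (Kerr.bilin M a) x =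
      48 * M ^ 2 * (((radius a x : ℂ) + ((a * (x 3 / radius a x) : ℝ) : ℂ) * Complex.I) ^ 6).re /
        (radius a x ^ 2 + (a * (x 3 / radius a x)) ^ 2) ^ 6)
    (hC : ∀ x : E4, 0 < radius a x → ∀ b : Module.Basis (Fin 4) ℝ E4,
      ∑ i, ∑ i', ∑ j, ∑ j', ∑ k, ∑ k',
        ginv (Kerr.bilin M a) b x i i' * ginv (Kerr.bilin M a) b x j j' *
        ginv (Kerr.bilin M a) b x k k' *
        traceCLM E4 ((riemAt (Kerr.bilin M a) x (b i) (b j)).comp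
          ((riemAt (Kerr.bilin M a) x (b j') (b k)).comp
            (riemAt (Kerr.bilin M a) x (b k') (b i')))) =
      48 * M ^ 3 * (((radius a x : ℂ) + ((a * (x 3 / radius a x) : ℝ) : ℂ) * Complex.I) ^ 9).re /
        (radius a x ^ 2 + (a * (x 3 / radius a x)) ^ 2) ^ 9)
    (X : Π x : exterior M a, TangentSpace 𝓘(ℝ, E4) x)
    (hX : (smoothMetric M a (rPlus M a)).toPseudoRiemannianMetric.IsKillingField X) :
    ∃ α β : ℝ, ∀ x : exterior M a,
      X x = α • stationaryField a (rPlus M a) x + β • axialField a (rPlus M a) x := by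
  classical
  have hM : 0 < M := hsub.pos
  set Xf : E4 → E4 := fun y ↦ if h : y ∈ exterior M a then X ⟨y, h⟩ else 0 with hXfdef
  have hXf : ∀ y : exterior M a, X y = Xf y := fun y ↦ by
    simp only [hXfdef, dif_pos y.2]
  have hsm : ∀ y : exterior M a, ContDiffAt ℝ ∞ Xf y := fun y ↦ hX.contDiffAt_coordRepr hXf y
  have hXfs : ContDiffOn ℝ ∞ Xf (region a (rPlus M a)) := fun y hy ↦ (hsm ⟨y, hy⟩).contDiffWithinAt
  have hLG : ∀ x ∈ (region a (rPlus M a) : Set E4), ∀ v w : E4,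
      fderiv ℝ (bilin M a) x (Xf x) v w + bilin M a x (fderiv ℝ Xf x v) w +
        bilin M a x v (fderiv ℝ Xf x w) = 0 :=
    fun x hx v w ↦ killing_coord_lie_eq_zero M a (rPlus M a) hX hXf ⟨x, hx⟩ v w
  have htan := killing_tangent_of_invariants hM ha hsub hK hC hXfs hLG
  obtain ⟨α, β, hαβ⟩ := killing_tangent_eq_const hM ha (X := Xf) (fun x hx _ ↦ hsm ⟨x, hx⟩)
    (fun x hx _ ↦ hLG x hx) (fun x hx _ ↦ htan x hx)
  refine ⟨α, β, fun x ↦ ?_⟩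
  have hres : Continuous fun y : exterior M a ↦ Xf y :=
    continuousOn_iff_continuous_restrict.1 hXfs.continuousOn
  have hcont : Continuous fun y : exterior M a ↦
      Xf y - (α • E4.basisVector 0 + β • E4.axialGenerator (y : E4)) :=
    hres.sub (continuous_const.add
      ((E4.axialGenerator.continuous.comp continuous_subtype_val).const_smul β))
  have h := eq_of_offAxis_region (c := (0 : E4)) hcont
    (fun y hax ↦ sub_eq_zero.2 (hαβ y y.2 hax)) x
  rw [sub_eq_zero] at h
  rw [hXf x, h, axialField_eq_axialGenerator]
  rfl

end Kerr

end Literature.Geometry.Lorentzian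

end
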